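/-
VALUE = THEOREM, NOT summit progress (cell b2b-lgcu-borel, gen 21); crux 14079 untouched.
-/
import Mathlib
import Summits.MatrixMultiplication.MatrixMultiplication.Theorems.LieRankDesigns.Negative.Basics

/-!
# Conjugation transport and monotonicity of identity designs on `GL_m(𝔽_p)` (every `m`, every level)

VALUE = THEOREM (bookkeeping that makes every coordinate exclusion intrinsic), NOT summit progress.

`DesignConj.lean` (gen 8) proved, for `GL₂` and level one only, that the identity-design clause of the
crux `SubgroupIdentityDesigns` is invariant under SIMULTANEOUS conjugation of the three members and
monotone under passing to sub-triples.  This file proves the same for `GL_m(𝔽_p)`, every `m`, and every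
level `k` (`design_transport`, `design_mono`, `design_conj`, and the contrapositive `no_design_of_conj_le`
used by the exclusion files): if `c` is a level-`k` identity design for `(H₁,H₂,H₃)` and
`x⁻¹ Kᵢ x ≤ Hᵢ` for one `x ∈ GL_m(𝔽_p)`, then `M ↦ c(x⁻¹ M x)` is a level-`k` identity design for
`(K₁,K₂,K₃)`: `Σ_M c(x⁻¹ M x) ψ(tr(M s)) = Σ_M c(M) ψ(tr(M · x⁻¹ s x))` (`fourier_conj`, reindexing by the
conjugation bijection of `Mat` and cyclicity of the trace) and `rk(x⁻¹ M x) = rk M`.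

CONSEQUENCE for the catalogue of excluded configurations (corner groups, dilatation families, transvection
groups, root chains `RootChain.lean`, …, all stated in coordinates): each exclusion "no triple with
`Kᵢ ≤ Hᵢ` carries a level-one design" holds verbatim for the simultaneously conjugated configuration
`x Kᵢ x⁻¹ ≤ Hᵢ` (`no_design_of_conj_le`), i.e. for every flag / frame of `𝔽_p^m`, not only the standard one.

HONEST SCOPE.  Pure transport; proves no new exclusion by itself.
-/

set_option linter.dupNamespace false

noncomputable section

open scoped BigOperators Matrix Classical
open Summit.MatrixMultiplication.MatrixMultiplication.Theorems.LieRankDesigns.Negative (GLm Mat)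

namespace Summit.MatrixMultiplication.MatrixMultiplication.Theorems.SubgroupIdentityDesigns.Negative
namespace DesignConjGL

variable {p m : ℕ}

/-- `x x⁻¹ = 1` as matrices. -/
theorem coe_mul_coe_inv (x : GLm p m) :
    (x : Mat p m) * ((x⁻¹ : GLm p m) : Mat p m) = 1 := by
  rw [← Units.val_mul, mul_inv_cancel, Units.val_one]

/-- `x⁻¹ x = 1` as matrices. -/
theorem coe_inv_mul_coe (x : GLm p m) :
    ((x⁻¹ : GLm p m) : Mat p m) * (x : Mat p m) = 1 := by
  rw [← Units.val_mul, inv_mul_cancel, Units.val_one]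

/-- The conjugation bijection `M ↦ x⁻¹ M x` of `Mat_m(𝔽_p)`. -/
def conjMat (x : GLm p m) : Mat p m ≃ Mat p m where
  toFun M := ((x⁻¹ : GLm p m) : Mat p m) * M * (x : Mat p m)
  invFun N := (x : Mat p m) * N * ((x⁻¹ : GLm p m) : Mat p m)
  left_inv M := by
    show (x : Mat p m) * (((x⁻¹ : GLm p m) : Mat p m) * M * (x : Mat p m)) *
      ((x⁻¹ : GLm p m) : Mat p m) = M
    rw [← mul_assoc, ← mul_assoc, coe_mul_coe_inv, one_mul, mul_assoc, coe_mul_coe_inv, mul_one]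
  right_inv N := by
    show ((x⁻¹ : GLm p m) : Mat p m) * ((x : Mat p m) * N * ((x⁻¹ : GLm p m) : Mat p m)) *
      (x : Mat p m) = N
    rw [← mul_assoc, ← mul_assoc, coe_inv_mul_coe, one_mul, mul_assoc, coe_inv_mul_coe, mul_one]

/-- `conjMat x M = x⁻¹ M x`. -/
theorem conjMat_apply (x : GLm p m) (M : Mat p m) :
    conjMat x M = ((x⁻¹ : GLm p m) : Mat p m) * M * (x : Mat p m) := rfl

/-- Conjugation preserves the rank: `rk(x⁻¹ M x) = rk M`. -/
theorem rank_conjMat (x : GLm p m) (M : Mat p m) : (conjMat x M).rank = M.rank := by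
  rw [conjMat_apply, Matrix.rank_mul_eq_left_of_isUnit_det (x : Mat p m) _
      (Matrix.isUnit_det_of_right_inverse (coe_mul_coe_inv x)),
    Matrix.rank_mul_eq_right_of_isUnit_det ((x⁻¹ : GLm p m) : Mat p m) M
      (Matrix.isUnit_det_of_left_inverse (coe_mul_coe_inv x))]

/-- Membership transport for `Subgroup.map (MulAut.conj x)`: `x⁻¹ (x h x⁻¹) x = h ∈ H`. -/
theorem inv_mul_mul_mem_of_mem_map {H : Subgroup (GLm p m)} (x : GLm p m) :
    ∀ g ∈ H.map (MulAut.conj x).toMonoidHom, x⁻¹ * g * x ∈ H := by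
  intro g hg
  obtain ⟨h, hh, rfl⟩ := Subgroup.mem_map.mp hg
  simpa [MulAut.conj_apply, mul_assoc] using hh

variable [hp : Fact p.Prime]

/-- **Fourier transport**: `Σ_M c(x⁻¹ M x) ψ(tr(M s)) = Σ_M c(M) ψ(tr(M x⁻¹ s x))`. -/
theorem fourier_conj (c : Mat p m → ℂ) (x : GLm p m) (s : Mat p m) :
    (∑ M : Mat p m, c (conjMat x M) * ZMod.stdAddChar (Matrix.trace (M * s))) =
      ∑ M : Mat p m, c M * ZMod.stdAddChar (Matrix.trace (M * conjMat x s)) := by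
  refine Fintype.sum_equiv (conjMat x) _ _ fun M => ?_
  -- `tr(x⁻¹ M x · x⁻¹ s x) = tr(M s)`
  have htr : Matrix.trace (conjMat x M * conjMat x s) = Matrix.trace (M * s) := by
    rw [conjMat_apply, conjMat_apply,
      show ((x⁻¹ : GLm p m) : Mat p m) * M * (x : Mat p m) *
          (((x⁻¹ : GLm p m) : Mat p m) * s * (x : Mat p m)) =
        ((x⁻¹ : GLm p m) : Mat p m) * (M * s * (x : Mat p m)) by
        rw [← mul_assoc, ← mul_assoc, mul_assoc _ (x : Mat p m), coe_mul_coe_inv, mul_one]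
        simp only [mul_assoc],
      Matrix.trace_mul_comm, mul_assoc, coe_mul_coe_inv, mul_one]
  rw [htr]

/-- **TRANSPORT.**  If `x⁻¹ Kᵢ x ≤ Hᵢ` (`i = 1,2,3`, one `x`), a level-`k` identity design for
`(H₁,H₂,H₃)` yields one for `(K₁,K₂,K₃)` (namely `M ↦ c(x⁻¹ M x)`). -/
theorem design_transport (k : ℕ) {H₁ H₂ H₃ K₁ K₂ K₃ : Subgroup (GLm p m)} (x : GLm p m)
    (hK₁ : ∀ g ∈ K₁, x⁻¹ * g * x ∈ H₁) (hK₂ : ∀ g ∈ K₂, x⁻¹ * g * x ∈ H₂)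
    (hK₃ : ∀ g ∈ K₃, x⁻¹ * g * x ∈ H₃)
    (h : ∃ c : Mat p m → ℂ, (∀ M, k < M.rank → c M = 0) ∧
      (∑ M, c M * ZMod.stdAddChar (Matrix.trace (M * ((1 : GLm p m) : Mat p m)))) = 1 ∧
      ∀ a ∈ H₁, ∀ b ∈ H₂, ∀ g ∈ H₃, a * b * g ≠ 1 →
        (∑ M, c M * ZMod.stdAddChar (Matrix.trace (M * ((a * b * g : GLm p m) : Mat p m)))) = 0) :
    ∃ c : Mat p m → ℂ, (∀ M, k < M.rank → c M = 0) ∧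
      (∑ M, c M * ZMod.stdAddChar (Matrix.trace (M * ((1 : GLm p m) : Mat p m)))) = 1 ∧
      ∀ a ∈ K₁, ∀ b ∈ K₂, ∀ g ∈ K₃, a * b * g ≠ 1 →
        (∑ M, c M * ZMod.stdAddChar (Matrix.trace (M * ((a * b * g : GLm p m) : Mat p m)))) = 0 := by
  obtain ⟨c, hc, h1, h0⟩ := h
  refine ⟨fun M => c (conjMat x M), fun M hM => hc _ (by rwa [rank_conjMat]), ?_, ?_⟩
  · rw [fourier_conj, conjMat_apply, Units.val_one, mul_one, coe_inv_mul_coe]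
    simpa only [Units.val_one, mul_one] using h1
  · intro a ha b hb g hg hne
    rw [fourier_conj, conjMat_apply]
    have hval : ((x⁻¹ : GLm p m) : Mat p m) * ((a * b * g : GLm p m) : Mat p m) * (x : Mat p m) =
        (((x⁻¹ * a * x) * (x⁻¹ * b * x) * (x⁻¹ * g * x) : GLm p m) : Mat p m) := by
      rw [show x⁻¹ * a * x * (x⁻¹ * b * x) * (x⁻¹ * g * x) = x⁻¹ * (a * b * g) * x by group]
      simp only [Units.val_mul]
    rw [hval]
    refine h0 _ (hK₁ a ha) _ (hK₂ b hb) _ (hK₃ g hg) ?_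
    intro h1'
    apply hne
    have : a * b * g = x * (x⁻¹ * a * x * (x⁻¹ * b * x) * (x⁻¹ * g * x)) * x⁻¹ := by group
    rw [this, h1', mul_one, mul_inv_cancel]

/-- **MONOTONICITY.**  Sub-triples of a level-`k` design triple are level-`k` design triples. -/
theorem design_mono (k : ℕ) {H₁ H₂ H₃ K₁ K₂ K₃ : Subgroup (GLm p m)} (h₁ : K₁ ≤ H₁) (h₂ : K₂ ≤ H₂)
    (h₃ : K₃ ≤ H₃)
    (h : ∃ c : Mat p m → ℂ, (∀ M, k < M.rank → c M = 0) ∧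
      (∑ M, c M * ZMod.stdAddChar (Matrix.trace (M * ((1 : GLm p m) : Mat p m)))) = 1 ∧
      ∀ a ∈ H₁, ∀ b ∈ H₂, ∀ g ∈ H₃, a * b * g ≠ 1 →
        (∑ M, c M * ZMod.stdAddChar (Matrix.trace (M * ((a * b * g : GLm p m) : Mat p m)))) = 0) :
    ∃ c : Mat p m → ℂ, (∀ M, k < M.rank → c M = 0) ∧
      (∑ M, c M * ZMod.stdAddChar (Matrix.trace (M * ((1 : GLm p m) : Mat p m)))) = 1 ∧
      ∀ a ∈ K₁, ∀ b ∈ K₂, ∀ g ∈ K₃, a * b * g ≠ 1 →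
        (∑ M, c M * ZMod.stdAddChar (Matrix.trace (M * ((a * b * g : GLm p m) : Mat p m)))) = 0 :=
  design_transport k 1 (fun g hg => by simpa using h₁ hg) (fun g hg => by simpa using h₂ hg)
    (fun g hg => by simpa using h₃ hg) h

/-- **CONJUGATION INVARIANCE.**  A level-`k` design for `(H₁,H₂,H₃)` gives one for
`(x H₁ x⁻¹, x H₂ x⁻¹, x H₃ x⁻¹)`; apply with `x⁻¹` for the converse. -/
theorem design_conj (k : ℕ) (H₁ H₂ H₃ : Subgroup (GLm p m)) (x : GLm p m)
    (h : ∃ c : Mat p m → ℂ, (∀ M, k < M.rank → c M = 0) ∧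
      (∑ M, c M * ZMod.stdAddChar (Matrix.trace (M * ((1 : GLm p m) : Mat p m)))) = 1 ∧
      ∀ a ∈ H₁, ∀ b ∈ H₂, ∀ g ∈ H₃, a * b * g ≠ 1 →
        (∑ M, c M * ZMod.stdAddChar (Matrix.trace (M * ((a * b * g : GLm p m) : Mat p m)))) = 0) :
    ∃ c : Mat p m → ℂ, (∀ M, k < M.rank → c M = 0) ∧
      (∑ M, c M * ZMod.stdAddChar (Matrix.trace (M * ((1 : GLm p m) : Mat p m)))) = 1 ∧
      ∀ a ∈ H₁.map (MulAut.conj x).toMonoidHom, ∀ b ∈ H₂.map (MulAut.conj x).toMonoidHom,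
        ∀ g ∈ H₃.map (MulAut.conj x).toMonoidHom, a * b * g ≠ 1 →
        (∑ M, c M * ZMod.stdAddChar (Matrix.trace (M * ((a * b * g : GLm p m) : Mat p m)))) = 0 :=
  design_transport k x (inv_mul_mul_mem_of_mem_map x) (inv_mul_mul_mem_of_mem_map x)
    (inv_mul_mul_mem_of_mem_map x) h

/-- **EXCLUSIONS ARE INTRINSIC.**  If NO triple `(H₁', H₂', H₃')` with `Kᵢ ≤ Hᵢ'` carries a level-`k`
design (a coordinate exclusion), then no triple with `x Kᵢ x⁻¹ ≤ Hᵢ` does. -/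
theorem no_design_of_conj_le (k : ℕ) {K₁ K₂ K₃ : Subgroup (GLm p m)}
    (hex : ∀ H₁ H₂ H₃ : Subgroup (GLm p m), K₁ ≤ H₁ → K₂ ≤ H₂ → K₃ ≤ H₃ →
      ¬ ∃ c : Mat p m → ℂ, (∀ M, k < M.rank → c M = 0) ∧
        (∑ M, c M * ZMod.stdAddChar (Matrix.trace (M * ((1 : GLm p m) : Mat p m)))) = 1 ∧
        ∀ a ∈ H₁, ∀ b ∈ H₂, ∀ g ∈ H₃, a * b * g ≠ 1 →
          (∑ M, c M * ZMod.stdAddChar (Matrix.trace (M * ((a * b * g : GLm p m) : Mat p m)))) = 0)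
    (x : GLm p m) {H₁ H₂ H₃ : Subgroup (GLm p m)}
    (h₁ : K₁.map (MulAut.conj x).toMonoidHom ≤ H₁) (h₂ : K₂.map (MulAut.conj x).toMonoidHom ≤ H₂)
    (h₃ : K₃.map (MulAut.conj x).toMonoidHom ≤ H₃) :
    ¬ ∃ c : Mat p m → ℂ, (∀ M, k < M.rank → c M = 0) ∧
      (∑ M, c M * ZMod.stdAddChar (Matrix.trace (M * ((1 : GLm p m) : Mat p m)))) = 1 ∧
      ∀ a ∈ H₁, ∀ b ∈ H₂, ∀ g ∈ H₃, a * b * g ≠ 1 →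
        (∑ M, c M * ZMod.stdAddChar (Matrix.trace (M * ((a * b * g : GLm p m) : Mat p m)))) = 0 := by
  intro h
  -- conjugate the whole triple back by `x⁻¹`: `x⁻¹ Hᵢ x ⊇ Kᵢ`
  have h' := design_conj k H₁ H₂ H₃ x⁻¹ h
  refine hex _ _ _ ?_ ?_ ?_ h'
  all_goals
    intro g hg
    refine Subgroup.mem_map.mpr ⟨x * g * x⁻¹, ?_, by simp [mul_assoc]⟩
  · exact h₁ (Subgroup.mem_map.mpr ⟨g, hg, by simp [MulAut.conj_apply]⟩)
  · exact h₂ (Subgroup.mem_map.mpr ⟨g, hg, by simp [MulAut.conj_apply]⟩)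
  · exact h₃ (Subgroup.mem_map.mpr ⟨g, hg, by simp [MulAut.conj_apply]⟩)

end DesignConjGL
end Summit.MatrixMultiplication.MatrixMultiplication.Theorems.SubgroupIdentityDesigns.Negative
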